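import Mathlib
import HarnessLib.Audit
import Summits.PneNP.PneNP.Theorems.PstarTerminalFiveAssembly
import Summits.PneNP.PneNP.Theorems.PstarFreeMonomial
import Summits.PneNP.PneNP.Theorems.PstarMinimalCoreClean

/-!
# Path-sum sub-cores fold only skeleton outputs: the (A)-node without clean folds (ROUND-24, O1/O2; memo g23 §29)

FRONTIER range-avoidance ladder, rung F-N3, ROUND 24 (cell `pnp-ideate`, prover-2 memo `g23/O1-TWOCLEAN-g23.md` §29; typed targets
`PstarCoreBoundTargets.TerminalFive` / `TerminalPeelable` (p646951); restricted-model proof complexity — nothing here bears on `P` versus `NP`).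

By `PstarFreeMonomial.false_of_free_monomial` a terminal core has no monomial whose AND pair is private to it.  In a branch-(A) sub-core
`(K₀; d₁, d₂)` of a chord `c` (`PstarTerminalFiveAssembly.NoSmallPathSumSubcore`, internal menu) a FOLD output `f ∈ J₀ ∖ K₀` that is an
outside-gated CHORD of `J₀` would be such a monomial: its privates are read by no output of `K₀`, by no other fold, and by no internal menu monomial
(those would be inside gates on `f`).  Hence the (A)-node only needs sub-cores whose folds are NON-CLEAN outputs (non-chords and dirty chords — the
"skeleton", exactly as for branch (B), `PstarShortCoincidenceEndpoints`):

* `NoSkeletalPathSumSubcore I r y J₀ c 𝒢` — `NoSmallPathSumSubcore` for the internal menu of `𝒢`, restricted to sub-cores none of whose fold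
  outputs (members of `J₀` among the monomials of `d₁, d₂`) is an outside-gated chord of `J₀` for the menu `𝒢`;
* `noSmallPathSumSubcore_of_skeletal` — it implies `NoSmallPathSumSubcore I r y J₀ c (internalMenu I J₀ 𝒢)`;
* `CleanSkeletalCriterionBound` (OPEN, census-type) and **`terminalFive_of_skeletalBound : TerminalFiveA → CleanSkeletalCriterionBound → TerminalFive`**;
* (appended) `outsideGated_sub_of_clean`, **`false_of_minimal_subcore_two_clean`** — a CYCLE-shaped sub-core (`K₀` minimally XOR-closed: `C₃`, `C₄`,
  `C₅`) contains at most one outside-gated chord of `J₀` (`PstarMinimalCoreClean`), a further `k`-independent pruning of the (A)-census.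

No Assumption A, no genericity.
-/

set_option linter.dupNamespace false -- `Summit.PneNP.PneNP.…`: summit = sub-problem name (D-0017 single-conjunct layout)

open Finset Literature.Computability.Complexity
open Summit.PneNP.PneNP.Theorems.PstarTyped (Typed)
open Summit.PneNP.PneNP.Theorems.PstarSALevel (varSet bdry BoundaryExpanding SimpleOverlap)
open Summit.PneNP.PneNP.Theorems.PstarXCore (xverts)
open Summit.PneNP.PneNP.Theorems.PstarGapPeeling (not_mem_varSet_of_private)
open Summit.PneNP.PneNP.Theorems.PstarCentreFree (vars_mem_varSet)
open Summit.PneNP.PneNP.Theorems.PstarGapOneAll (gval)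
open Summit.PneNP.PneNP.Theorems.PstarCoreBound (XorClosed)
open Summit.PneNP.PneNP.Theorems.PstarChordRepair (IsChord)
open Summit.PneNP.PneNP.Theorems.PstarCoreBoundTargets (Terminal TerminalFive TerminalFiveA TerminalPeelable terminalPeelable_of_terminalFive)
open Summit.PneNP.PneNP.Theorems.PstarSharingBound (sharedSlots)
open Summit.PneNP.PneNP.Theorems.PstarChordBridgeTools (xpdeg)
open Summit.PneNP.PneNP.Theorems.PstarChordReadOutside (IsGate OutsideGated touches_of_slot)
open Summit.PneNP.PneNP.Theorems.PstarChordReadFibre (outside mem_outside)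
open Summit.PneNP.PneNP.Theorems.PstarSliceGenericCriterion (NoShortCoincidence)
open Summit.PneNP.PneNP.Theorems.PstarSliceGenericInternal (internalMenu mem_internalMenu internalMenu_subset)
open Summit.PneNP.PneNP.Theorems.PstarTerminalFiveAssembly (NoSmallPathSumSubcore CleanSmallCriterionBound terminalFive_of_bound)
open Summit.PneNP.PneNP.Theorems.PstarFreeMonomial (false_of_free_monomial)
open Summit.PneNP.PneNP.Theorems.PstarMinimalCoreClean (MinimalXorClosed false_of_minimal_two_clean)
open Summit.PneNP.PneNP.Theorems.PstarNorUnitDirAssembly (isChord_of_subset)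

namespace Summit.PneNP.PneNP.Theorems.PstarSkeletalSubcores

variable {n m : ℕ}

/-- **BRANCH (A), SKELETAL FOLDS ONLY**: `NoSmallPathSumSubcore` for the internal menu, restricted to sub-cores `(K₀; d₁, d₂)` in which no output of
`J₀` among the monomials of `d₁, d₂` (a fold) is an outside-gated chord of `J₀` (menu `𝒢`). -/
def NoSkeletalPathSumSubcore (I : LocalMap 4 n m) (r : ℕ) (y : Fin m → Bool) (J₀ : Finset (Fin m)) (c : Fin m) (𝒢 : Finset (Fin m)) : Prop :=
  ∀ K₀ ⊆ J₀.erase c, K₀.Nonempty → XorClosed I K₀ → K₀.card ≤ 5 →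
    ∀ (F₁ F₂ : Finset (Fin m)) (t : Bool) (d₁ d₂ : Finset (Fin n) × Finset (Fin m) × Bool),
      F₁ ⊆ (J₀.erase c) \ K₀ → F₂ ⊆ (J₀.erase c) \ K₀ → d₁.2.1 = F₁ → d₂.2.1 ⊆ internalMenu I J₀ 𝒢 ∪ F₂ → d₁ ≠ d₂ →
      (∀ f ∈ d₁.2.1 ∪ d₂.2.1, f ∈ J₀ → IsChord I J₀ f → ¬ OutsideGated I J₀ 𝒢 f) →
      (∀ v, v ∈ d₁.1 ↔ Odd (xpdeg I (insert c F₁) v)) → (∀ v ∈ d₁.1, ∃ f ∈ K₀, v ∈ varSet I f) →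
      (∀ v ∈ d₂.1, (∃ f ∈ K₀, v ∈ varSet I f) ∨ ∃ g ∈ d₁.2.1 ∪ d₂.2.1, I.vars g 2 = v ∨ I.vars g 3 = v) →
      (∀ z : Fin n → Bool, (∀ f ∈ F₁, I.eval z f = y f) →
        (gval I d₁.1 d₁.2.1 z = d₁.2.2 ↔ xor (z (I.vars c 0)) (z (I.vars c 1)) = t)) →
      ¬ Terminal I r y K₀ d₁ d₂

variable {I : LocalMap 4 n m} {r : ℕ} {y : Fin m → Bool} {J₀ 𝒢 : Finset (Fin m)} {c : Fin m}

/-- **A clean chord of `J₀` folded into a sub-core is a free monomial**: a terminal sub-core `(K₀; d₁, d₂)` with `K₀ ⊆ J₀`, monomials among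
`J₀ ∖ K₀` and the internal menu of `𝒢`, cannot have an outside-gated chord of `J₀` among its monomials. -/
theorem false_of_clean_fold (hI : I.IsPure xorAndPred) (hT : Typed I) (hS : SimpleOverlap I) (hB : BoundaryExpanding r I) {K₀ : Finset (Fin m)}
    {d₁ d₂ : Finset (Fin n) × Finset (Fin m) × Bool} (ht : Terminal I r y K₀ d₁ d₂) (hK₀ : K₀ ⊆ J₀) (hdisj : Disjoint J₀ 𝒢)
    (hmono : d₁.2.1 ∪ d₂.2.1 ⊆ internalMenu I J₀ 𝒢 ∪ (J₀ \ K₀)) {f : Fin m} (hf : f ∈ d₁.2.1 ∪ d₂.2.1) (hfJ : f ∈ J₀) (hch : IsChord I J₀ f)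
    (hO : OutsideGated I J₀ 𝒢 f) : False := by
  have hfK : f ∉ K₀ := by
    rcases mem_union.1 (hmono hf) with h | h
    · exact absurd hfJ (disjoint_right.1 hdisj (internalMenu_subset I J₀ 𝒢 h))
    · exact (mem_sdiff.1 h).2
  -- the privates of `f` are read by no output of `K₀`
  have privK : ∀ s : Fin 4, 2 ≤ s.val → ∀ j ∈ K₀, I.vars f s ∉ varSet I j := by
    intro s hs j hj
    have hb : I.vars f s ∈ bdry I J₀ := by
      have h4 : ∀ t : Fin 4, 2 ≤ t.val → t = 2 ∨ t = 3 := by decide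
      rcases h4 s hs with rfl | rfl
      exacts [hch.1, hch.2]
    exact not_mem_varSet_of_private I hfJ (hK₀ hj) (fun e => hfK (e ▸ hj)) hb (vars_mem_varSet I f s)
  -- and by no other monomial
  have privG : ∀ s : Fin 4, 2 ≤ s.val → ∀ g' ∈ d₁.2.1 ∪ d₂.2.1, g' ≠ f → I.vars g' 2 ≠ I.vars f s ∧ I.vars g' 3 ≠ I.vars f s := by
    intro s hs g' hg' hne
    have hv : I.vars f s = I.vars f 2 ∨ I.vars f s = I.vars f 3 := by
      have h4 : ∀ t : Fin 4, 2 ≤ t.val → t = 2 ∨ t = 3 := by decide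
      rcases h4 s hs with rfl | rfl
      exacts [Or.inl rfl, Or.inr rfl]
    rcases mem_union.1 (hmono hg') with h | h
    · -- an internal menu monomial touching `f` would be an inside gate
      obtain ⟨hg𝒢, h2, h3⟩ := (mem_internalMenu I).1 h
      by_contra hbad
      have htouch : I.vars g' 2 = I.vars f s ∨ I.vars g' 3 = I.vars f s := by
        by_contra hh; push Not at hh; exact hbad hh
      obtain ⟨v, z, hGate⟩ := hO g' hg𝒢 (touches_of_slot hv htouch)
      have hz : z ∈ outside I J₀ := (mem_outside I).2 hGate.2.2
      rcases hGate.2.1 with ⟨-, e3⟩ | ⟨e2, -⟩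
      · exact h3 (e3 ▸ hz)
      · exact h2 (e2 ▸ hz)
    · -- another output of `J₀` does not read a private of `f`
      obtain ⟨hg'J, -⟩ := mem_sdiff.1 h
      have hb : I.vars f s ∈ bdry I J₀ := by
        have h4 : ∀ t : Fin 4, 2 ≤ t.val → t = 2 ∨ t = 3 := by decide
        rcases h4 s hs with rfl | rfl
        exacts [hch.1, hch.2]
      have hnot := not_mem_varSet_of_private I hfJ hg'J hne hb (vars_mem_varSet I f s)
      exact ⟨fun e => hnot (e ▸ vars_mem_varSet I g' 2), fun e => hnot (e ▸ vars_mem_varSet I g' 3)⟩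
  exact false_of_free_monomial hI hT hS hB ht hf (privK 2 (by decide)) (privK 3 (by decide)) (privG 2 (by decide)) (privG 3 (by decide))

/-- **The skeletal node gives the small node** (internal menu). -/
theorem noSmallPathSumSubcore_of_skeletal (hI : I.IsPure xorAndPred) (hT : Typed I) (hS : SimpleOverlap I) (hB : BoundaryExpanding r I)
    (hdisj : Disjoint J₀ 𝒢) (h : NoSkeletalPathSumSubcore I r y J₀ c 𝒢) : NoSmallPathSumSubcore I r y J₀ c (internalMenu I J₀ 𝒢) := by
  intro K₀ hK₀ hne hX h5 F₁ F₂ t d₁ d₂ hF₁ hF₂ hm₁ hm₂ hne' hlin hread hread₂ hslice ht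
  have hK₀J : K₀ ⊆ J₀ := hK₀.trans (erase_subset c J₀)
  have hmono : d₁.2.1 ∪ d₂.2.1 ⊆ internalMenu I J₀ 𝒢 ∪ (J₀ \ K₀) := by
    have hF : (J₀.erase c) \ K₀ ⊆ J₀ \ K₀ := sdiff_subset_sdiff (erase_subset c J₀) (Subset.refl _)
    refine union_subset ?_ (hm₂.trans (union_subset_union (Subset.refl _) (hF₂.trans hF)))
    rw [hm₁]
    exact (hF₁.trans hF).trans subset_union_right
  by_cases hclean : ∃ f ∈ d₁.2.1 ∪ d₂.2.1, f ∈ J₀ ∧ IsChord I J₀ f ∧ OutsideGated I J₀ 𝒢 f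
  · obtain ⟨f, hf, hfJ, hch, hO⟩ := hclean
    exact false_of_clean_fold hI hT hS hB ht hK₀J hdisj hmono hf hfJ hch hO
  · push Not at hclean
    exact h K₀ hK₀ hne hX h5 F₁ F₂ t d₁ d₂ hF₁ hF₂ hm₁ hm₂ hne' (fun f hf hfJ hch => hclean f hf hfJ hch) hlin hread hread₂ hslice ht

/-! ## The census node with skeletal folds, and the core bound from it -/

/-- **`CleanSkeletalCriterionBound` (OPEN, census-type)**: as `PstarTerminalFiveAssembly.CleanSmallCriterionBound`, with the (A)-half replaced by the
weaker `NoSkeletalPathSumSubcore` (sub-cores of at most five outputs folding only non-clean outputs, internal menu).  FRONTIER. -/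
@[conjecture] def CleanSkeletalCriterionBound : Prop :=
  ∀ (n m r : ℕ) (I : LocalMap 4 n m), I.IsPure xorAndPred → Typed I → SimpleOverlap I → BoundaryExpanding r I →
    ∀ (y : Fin m → Bool) (J₀ : Finset (Fin m)) (w₁ w₂ : Finset (Fin n) × Finset (Fin m) × Bool), Terminal I r y J₀ w₁ w₂ →
      (∃ S ⊆ J₀, S.Nonempty ∧ (∀ w ∈ xverts I S, 2 ≤ xpdeg I S w) ∧ ∀ f ∈ S, ¬ IsChord I J₀ f) →
      ∃ ℬ ⊆ J₀, ℬ.card + 2 ≤ (sharedSlots I J₀).card ∧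
        ∀ c ∈ J₀, c ∉ ℬ → IsChord I J₀ c → OutsideGated I J₀ (w₁.2.1 ∪ w₂.2.1) c →
          NoSkeletalPathSumSubcore I r y J₀ c (w₁.2.1 ∪ w₂.2.1) ∧ NoShortCoincidence I J₀ c (internalMenu I J₀ (w₁.2.1 ∪ w₂.2.1))

/-- The skeletal bound implies the small bound. -/
theorem cleanSmallCriterionBound_of_skeletal (h : CleanSkeletalCriterionBound) : CleanSmallCriterionBound := by
  intro n m r I hI hT hS hB y J₀ w₁ w₂ ht hS₀
  obtain ⟨ℬ, hℬJ, hℬ, hgood⟩ := h n m r I hI hT hS hB y J₀ w₁ w₂ ht hS₀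
  have hdisj : Disjoint J₀ (w₁.2.1 ∪ w₂.2.1) := disjoint_union_right.2 ⟨ht.2.2.2.1, ht.2.2.2.2.1⟩
  refine ⟨ℬ, hℬJ, hℬ, fun c hc hcℬ hch hO => ?_⟩
  obtain ⟨hA, hBc⟩ := hgood c hc hcℬ hch hO
  exact ⟨noSmallPathSumSubcore_of_skeletal hI hT hS hB hdisj hA, hBc⟩

/-- **THE CORE BOUND FROM O2 AND THE SKELETAL CRITERION BOUND.** -/
theorem terminalFive_of_skeletalBound (hO2 : TerminalFiveA) (hb : CleanSkeletalCriterionBound) : TerminalFive :=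
  terminalFive_of_bound hO2 (cleanSmallCriterionBound_of_skeletal hb)

/-- **O1 from the same inputs.** -/
theorem terminalPeelable_of_skeletalBound (hO2 : TerminalFiveA) (hb : CleanSkeletalCriterionBound) : TerminalPeelable :=
  terminalPeelable_of_terminalFive (terminalFive_of_skeletalBound hO2 hb)

/-! ## Cycle-shaped sub-cores carry at most one clean chord of `J₀` -/
section MinimalSub

variable {I : LocalMap 4 n m} {r : ℕ} {y : Fin m → Bool} {J₀ 𝒢 K₀ M : Finset (Fin m)}

/-- **A clean chord of `J₀` inside a sub-core is untouched by the sub-core's menu**: for `K₀ ⊆ J₀` and a menu `M` inside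
`internalMenu I J₀ 𝒢 ∪ (J₀ ∖ K₀)`, an outside-gated chord `e ∈ K₀` of `J₀` is an outside-gated chord of `K₀` for `M` (indeed no member of `M` touches it). -/
theorem outsideGated_sub_of_clean (hK₀ : K₀ ⊆ J₀) (hM : M ⊆ internalMenu I J₀ 𝒢 ∪ (J₀ \ K₀)) {e : Fin m} (he : e ∈ K₀) (hch : IsChord I J₀ e)
    (hO : OutsideGated I J₀ 𝒢 e) : IsChord I K₀ e ∧ OutsideGated I K₀ M e := by
  refine ⟨isChord_of_subset I hK₀ he hch, fun g hg ht => ?_⟩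
  exfalso
  -- some AND slot of `g` is a private of `e`
  have hslot : ∃ s : Fin 4, 2 ≤ s.val ∧ (I.vars g 2 = I.vars e s ∨ I.vars g 3 = I.vars e s) := by
    unfold PstarChordReadSwitches.Touches at ht
    by_contra hno
    push Not at hno
    exact ht ⟨⟨(hno 2 (by decide)).1, (hno 2 (by decide)).2⟩, ⟨(hno 3 (by decide)).1, (hno 3 (by decide)).2⟩⟩
  obtain ⟨s, hs, hgs⟩ := hslot
  have hv : I.vars e s = I.vars e 2 ∨ I.vars e s = I.vars e 3 := by
    have h4 : ∀ t : Fin 4, 2 ≤ t.val → t = 2 ∨ t = 3 := by decide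
    rcases h4 s hs with rfl | rfl
    exacts [Or.inl rfl, Or.inr rfl]
  have hb : I.vars e s ∈ bdry I J₀ := by
    have h4 : ∀ t : Fin 4, 2 ≤ t.val → t = 2 ∨ t = 3 := by decide
    rcases h4 s hs with rfl | rfl
    exacts [hch.1, hch.2]
  rcases mem_union.1 (hM hg) with h | h
  · obtain ⟨hg𝒢, h2, h3⟩ := (mem_internalMenu I).1 h
    obtain ⟨v, z, hGate⟩ := hO g hg𝒢 (touches_of_slot hv hgs)
    have hz : z ∈ outside I J₀ := (mem_outside I).2 hGate.2.2
    rcases hGate.2.1 with ⟨-, e3⟩ | ⟨e2, -⟩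
    · exact h3 (e3 ▸ hz)
    · exact h2 (e2 ▸ hz)
  · obtain ⟨hgJ, hgK⟩ := mem_sdiff.1 h
    have hne : g ≠ e := fun h' => hgK (h' ▸ he)
    have hnot := not_mem_varSet_of_private I (hK₀ he) hgJ hne hb (vars_mem_varSet I e s)
    rcases hgs with h' | h'
    · exact hnot (h' ▸ vars_mem_varSet I g 2)
    · exact hnot (h' ▸ vars_mem_varSet I g 3)

/-- **A CYCLE-SHAPED SUB-CORE CARRIES AT MOST ONE CLEAN CHORD OF `J₀`**: a terminal sub-core `(K₀; d₁, d₂)` with `K₀ ⊆ J₀` minimally XOR-closed and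
monomials in `internalMenu I J₀ 𝒢 ∪ (J₀ ∖ K₀)` cannot contain two distinct outside-gated chords of `J₀` (`PstarMinimalCoreClean.false_of_minimal_two_clean`). -/
theorem false_of_minimal_subcore_two_clean (hI : I.IsPure xorAndPred) (hT : Typed I) (hS : SimpleOverlap I) (hB : BoundaryExpanding r I)
    {d₁ d₂ : Finset (Fin n) × Finset (Fin m) × Bool} (ht : Terminal I r y K₀ d₁ d₂) (hK₀ : K₀ ⊆ J₀)
    (hmin : MinimalXorClosed I K₀) (hmono : d₁.2.1 ∪ d₂.2.1 ⊆ internalMenu I J₀ 𝒢 ∪ (J₀ \ K₀)) {e e' : Fin m}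
    (he : e ∈ K₀) (he' : e' ∈ K₀) (hne : e ≠ e') (hch : IsChord I J₀ e) (hch' : IsChord I J₀ e') (hO : OutsideGated I J₀ 𝒢 e)
    (hO' : OutsideGated I J₀ 𝒢 e') : False := by
  obtain ⟨hchK, hOK⟩ := outsideGated_sub_of_clean hK₀ hmono he hch hO
  obtain ⟨hchK', hOK'⟩ := outsideGated_sub_of_clean hK₀ hmono he' hch' hO'
  exact false_of_minimal_two_clean hI hT hS hB ht hmin he he' hne hchK hchK' hOK hOK'

end MinimalSub

end Summit.PneNP.PneNP.Theorems.PstarSkeletalSubcores
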